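import Mathlib
import HarnessLib

/-!
# Soft four-rings: the bond-to-cap statement (definition)

Route `PricedLinkCensus`, sub-problem `Crystallization`, item `SoftFourRings`
(stmt-AtomisticToContinuum-14234).  This file only DEFINES the proposition `BondToCap`, the
remaining hypothesis of the `Cap` variant of the soft-four-rings chain
(`Cap.softFourRings_of_labelledRigidity`, files `PricedLinkCensusSoftFourRingsCap*`):

  `SoftFourRings ⇐ BondToCap ∧ LabelledRigidity (6/25)`, and `LabelledRigidity (6/25)` is proved
  (`Rig.labelledRigidity_holds`), so `SoftFourRings ⇐ BondToCap`.

It replaces the global named fact `musinTarasov2012_tammes_thirteen` (Tammes' problem for thirteen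
points, `d₁₃ < 57.175°`, margin `0.04°` over the computer-assisted optimum `57.1367°`) of the
original chain, which used it only to bound the empty caps of the twelve link directions.

**Statement.**  In the hull-level setting of the twelve-point reduction — twelve unit vectors `X`,
pairwise at cosine `≤ 1 − 1/(2·1.01²)` (angle `≥ 59.35°`), a family `B` of `24` bonds (pairs at
cosine `≥ 1 − 1.01²/2`, angle `≤ 60.66°`), four at every point, non-bonded pairs at cosine
`< 1.01/2` — every unit vector `p` is within chordal distance `0.957` (angle `57.17°`) of a point of
`X`; i.e. the twelve directions have covering radius `< 57.175°` (no empty cap of that radius).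

**Status / evidence** (seat c3, item evidence `bond-to-cap.md`).  True with a large margin: the
extremal configurations are the cuboctahedral / anticuboctahedral links, covering radius `45°`
(square-face centres), `≈ 47°` at one percent.  It is implied by Tammes-13 (twelve of thirteen
points pairwise `≥ 59.35° > 57.175°`).  Without the bonds the statement is kissing-number-hard with
true margin `≈ 1°` (rattler hole of `P₁₃`).  Elementary partial result: the nearest point to `p` has
four bonds avoiding the cap, which forces angular distance `< 67.8°` (fan lemma).  A pole-centred
pair semidefinite relaxation (three-point kernels around `p`, 13-point Legendre couplings, degree
identities; solver and models in the seat folder) certifies covering radius `< 66.5° / 64.5° / 61.6°`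
at degrees `3 / 4 / 5`; the pseudo-moments at `57.175°` reproduce the exact cuboctahedral pair
statistics, so closing the last degrees needs either higher degree or genuinely three-point
(Bachoc–Vallentin-type) constraints, or the geometric rim/fan case analysis (`m = 3, 4, 5` rim
points of the maximal facet).
-/

namespace Summit.AtomisticToContinuum.Crystallization.Theorems.Cap

open Real RealInnerProductSpace

/-- **Bond-to-cap** (route-posited claim; the remaining hypothesis of the `Cap` variant of the
soft-four-rings chain, see the module docstring): in the hull-level setting of the twelve-point
reduction (twelve unit directions pairwise at cosine `≤ 1 − 1/(2·1.01²)`, `24` bonds at cosine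
`≥ 1 − 1.01²/2`, four at every point, non-bonds at cosine `< 1.01/2`), every unit vector is within
chordal distance `0.957` of one of the twelve directions. -/
def BondToCap : Prop :=
  ∀ (X : Finset (EuclideanSpace ℝ (Fin 3))) (B : Finset (Finset (EuclideanSpace ℝ (Fin 3)))),
    (∀ y ∈ X, ‖y‖ = 1) → X.card = 12 →
    (∀ u ∈ X, ∀ u' ∈ X, u ≠ u' → ⟪u, u'⟫ ≤ 1 - 1 / (2 * (101 / 100 : ℝ) ^ 2)) →
    (∀ T ∈ B, ∃ u ∈ X, ∃ u' ∈ X, u ≠ u' ∧ 1 - (101 / 100 : ℝ) ^ 2 / 2 ≤ ⟪u, u'⟫ ∧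
      T = {u, u'}) →
    B.card = 24 →
    (∀ v ∈ X, ∃ w : Fin 4 → EuclideanSpace ℝ (Fin 3), (∀ k, w k ∈ X) ∧
      Function.Injective w ∧ (∀ k, w k ≠ v) ∧
      (∀ k, ({v, w k} : Finset (EuclideanSpace ℝ (Fin 3))) ∈ B) ∧
      ∀ y, ({v, y} : Finset (EuclideanSpace ℝ (Fin 3))) ∈ B → ∃ k, y = w k) →
    (∀ u ∈ X, ∀ u' ∈ X, u ≠ u' → ({u, u'} : Finset (EuclideanSpace ℝ (Fin 3))) ∉ B →
      ⟪u, u'⟫ < 101 / 200) →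
    ∀ p : EuclideanSpace ℝ (Fin 3), ‖p‖ = 1 → ∃ x ∈ X, dist p x < 0.957

end Summit.AtomisticToContinuum.Crystallization.Theorems.Cap
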